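import Literature.AlgebraicGeometry.Resolution.WeightedCentreStep
import HarnessLib

/-!
# Upper pins: a centre variable that lies on no upper face monomial can be bought off (the invariant is not maximal)

[ATW24] Abramovich–Temkin–Włodarczyk, *Functorial embedded resolution via weighted blowings up*, Algebra & Number
Theory 18 (2024): §5.1 (p. 1575: the invariants `(a₁ ≤ ⋯ ≤ a_k)` and their order, truncations larger), Def. 2.4.1 (2)
(p. 1568: admissibility `v_J(f) ≥ 1`, i.e. `Σ dᵢ/aᵢ ≥ 1` on every monomial), Thm. 5.3.1 (2) (p. 1578:
`inv = max` over the admissible centres).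
[AQS25] Abramovich–Quek–Schober, Thm. 3.5 (the invariant as the lex-maximum over admissible centres).

## What is proved (polynomial model; `K` a field, finitely many variables)

Fix a cocharacter `γ ≥ 0` admissible for `F` (`v_γ ≥ 1` on the monomials of `F`) and a centre variable `j` (`γ_j > 0`,
entry `a_j = 1/γ_j`).  An **upper pin of `j`** is a FACE monomial `u^d` of `F` (`v_γ(u^d) = 1`) through `X_j` (`d_j ≥ 1`)
all of whose variables have weight `≥ γ_j`.

* **`exists_isAdmissibleFor_facePerturb`** — if `j` has NO upper pin (every face monomial through `X_j` contains a variable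
  of weight `< γ_j`, free variables included), then the perturbed cocharacter `facePerturb γ j η`
  (`γ'_j = γ_j − η`, `γ'_i = γ_i + η·a_j` for every `i` of weight `γ_i < γ_j`, the others unchanged) is again admissible
  for `F` for every small `η > 0`.  The three cases of the proof: `d_j = 0` (values only grow); `v_γ(u^d) > 1` (the loss
  `η d_j` is below the gap for `η ≤ (v−1)/d_j`); `v_γ(u^d) = 1`, `d_j ≥ 1` (a variable of lower weight gains
  `η a_j ≥ η d_j`, because `d_j γ_j ≤ 1` on a face).
* **`truncLex_exps_lt_exps_facePerturb`** — for small `η > 0` the invariant strictly INCREASES: `exps γ <_TL exps γ'`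
  (counting criterion `TruncLex.lt_of_countP` at the threshold `a_j`: equally many entries `≤ θ` for every `θ < a_j`, one
  entry fewer `≤ a_j`).
* **`IsCentreFor.exists_lt_of_no_upperPin`**, **`not_isMaxInv_of_no_upperPin`** — CENTRE SIDE: if `(Ψ, γ)` is a centre
  for `f` and some centre variable `j` has no upper pin on `Ψ⁻¹ f`, then `(Ψ, γ')` is a centre for `f` with
  `exps γ <_TL exps γ'`; hence `exps γ` is NOT `max W(f)`.  Contrapositive **`exists_upperPin_of_isMaxInv`**: at a centre
  attaining `max W(f)` every centre variable is upper-pinned.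
* Worked instance: `F = X₀X₁ + X₁³`, `γ₀ = (2/3, 1/3)` (admissible; the only face monomial through `X₀` is `X₀X₁`, which
  contains the lower-weight variable `X₁`, so `X₀` has no upper pin): `exps γ₀` (`= [3/2, 3]`) is not `max W(F)`; explicitly
  `η = 2/15` gives `γ' = (8/15, 8/15)` and `exps γ₀ <_TL exps γ'` (`[3/2, 3] < [15/8, 15/8]`).

Value type: typed lemmas in the polynomial `W(f)` model (a necessary condition on maximal centres) — not a resolution
theorem.
-/

noncomputable section

open MvPolynomial

namespace Literature.AlgebraicGeometry.Resolution

namespace WeightedBlowup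

/-! ## §1 The perturbation and its effect on the monomial valuation -/

section Perturb

variable {σ : Type*} [DecidableEq σ]

/-- **The face perturbation of `γ` at `j` with step `η`**: `γ'_j = γ_j − η`, `γ'_i = γ_i + η/γ_j` (`= γ_i + η·a_j`) for every
`i` of weight `γ_i < γ_j` (free variables included), `γ'_i = γ_i` otherwise. (derived here)
[cite: AbramovichTemkinWlodarczyk2024, Def. 2.4.1 (2) (p. 1568) and §5.1 (p. 1575)] -/
def facePerturb (γ : σ → ℚ) (j : σ) (η : ℚ) : σ → ℚ :=
  fun i => if i = j then γ j - η else if γ i < γ j then γ i + η / γ j else γ i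

/-- Value at `j`: `γ'_j = γ_j − η`. (derived here) [cite: AbramovichTemkinWlodarczyk2024, Def. 2.4.1 (2) (p. 1568) and §5.1 (p. 1575)] -/
@[simp] theorem facePerturb_self (γ : σ → ℚ) (j : σ) (η : ℚ) : facePerturb γ j η j = γ j - η := by
  simp [facePerturb]

/-- Value at a variable of lower weight: `γ'_i = γ_i + η/γ_j`. (derived here)
[cite: AbramovichTemkinWlodarczyk2024, Def. 2.4.1 (2) (p. 1568) and §5.1 (p. 1575)] -/
theorem facePerturb_of_lt (γ : σ → ℚ) (j : σ) (η : ℚ) {i : σ} (hi : γ i < γ j) :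
    facePerturb γ j η i = γ i + η / γ j := by
  have hij : i ≠ j := fun h => by subst h; exact lt_irrefl _ hi
  simp [facePerturb, hij, hi]

/-- Value at another variable of weight `≥ γ_j`: unchanged. (derived here)
[cite: AbramovichTemkinWlodarczyk2024, Def. 2.4.1 (2) (p. 1568) and §5.1 (p. 1575)] -/
theorem facePerturb_of_le (γ : σ → ℚ) (j : σ) (η : ℚ) {i : σ} (hij : i ≠ j) (hi : γ j ≤ γ i) :
    facePerturb γ j η i = γ i := by
  simp [facePerturb, hij, not_lt.2 hi]

/-- Away from `j` the weights do not decrease (`η ≥ 0`, `γ_j > 0`). [folklore] -/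
private theorem le_facePerturb (γ : σ → ℚ) {j : σ} (hj : 0 < γ j) {η : ℚ} (hη : 0 ≤ η) {i : σ} (hij : i ≠ j) :
    γ i ≤ facePerturb γ j η i := by
  by_cases hi : γ i < γ j
  · rw [facePerturb_of_lt γ j η hi]
    exact le_add_of_nonneg_right (div_nonneg hη hj.le)
  · rw [facePerturb_of_le γ j η hij (not_lt.1 hi)]

/-- The perturbed cocharacter is nonnegative for `0 ≤ η ≤ γ_j` (so it is again a cocharacter of a centre,
Def. 2.4.1 (1)). (derived here) [cite: AbramovichTemkinWlodarczyk2024, Def. 2.4.1 (1)–(2) (p. 1568)] -/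
theorem facePerturb_nonneg (γ : σ → ℚ) (hγ : ∀ i, 0 ≤ γ i) {j : σ} (hj : 0 < γ j) {η : ℚ} (hη : 0 ≤ η)
    (hηj : η ≤ γ j) (i : σ) : 0 ≤ facePerturb γ j η i := by
  by_cases hij : i = j
  · subst hij; rw [facePerturb_self]; exact sub_nonneg.2 hηj
  · exact (hγ i).trans (le_facePerturb γ hj hη hij)

/-- A lower-weight variable stays strictly below `γ_j` as long as `γ_i + η/γ_j < γ_j`. [folklore] -/
private theorem facePerturb_lt_of_lt (γ : σ → ℚ) (j : σ) {η : ℚ} {i : σ} (hi : γ i < γ j)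
    (hsmall : γ i + η / γ j < γ j) : facePerturb γ j η i < γ j := by
  rwa [facePerturb_of_lt γ j η hi]

variable [Fintype σ]

omit [DecidableEq σ] in
/-- `v_γ(u^d) = Σᵢ dᵢ γᵢ`. [cite: AbramovichTemkinWlodarczyk2024, §2.4 (monomial valuation of a center)] -/
theorem monomialValuation_eq_sum (γ : σ → ℚ) (d : σ →₀ ℕ) :
    monomialValuation γ d = ∑ i, (d i : ℚ) * γ i := by
  unfold monomialValuation
  rw [Finsupp.sum_fintype _ _ (fun i => by simp)]

omit [DecidableEq σ] in
/-- A single term is bounded by the valuation (`γ ≥ 0`). [folklore] -/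
private theorem mul_le_monomialValuation (γ : σ → ℚ) (hγ : ∀ i, 0 ≤ γ i) (d : σ →₀ ℕ) (i : σ) :
    (d i : ℚ) * γ i ≤ monomialValuation γ d := by
  rw [monomialValuation_eq_sum]
  exact Finset.single_le_sum (f := fun i => (d i : ℚ) * γ i)
    (fun i _ => mul_nonneg (Nat.cast_nonneg _) (hγ i)) (Finset.mem_univ i)

/-- **The valuation after perturbation**: `v_{γ'}(u^d) = v_γ(u^d) − η d_j + Σ_{i ≠ j} d_i (γ'_i − γ_i)`. [folklore] -/
private theorem monomialValuation_facePerturb_eq (γ : σ → ℚ) (j : σ) (η : ℚ) (d : σ →₀ ℕ) :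
    monomialValuation (facePerturb γ j η) d =
      monomialValuation γ d - η * d j +
        ∑ i ∈ Finset.univ.erase j, (d i : ℚ) * (facePerturb γ j η i - γ i) := by
  rw [monomialValuation_eq_sum, monomialValuation_eq_sum]
  have h1 : ∑ i, (d i : ℚ) * facePerturb γ j η i =
      ∑ i, (d i : ℚ) * γ i + ∑ i, (d i : ℚ) * (facePerturb γ j η i - γ i) := by
    rw [← Finset.sum_add_distrib]
    exact Finset.sum_congr rfl fun i _ => by ring
  rw [h1, ← Finset.add_sum_erase _ (fun i => (d i : ℚ) * (facePerturb γ j η i - γ i)) (Finset.mem_univ j),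
    facePerturb_self]
  ring

/-- The correction sum is nonnegative (`η ≥ 0`). [folklore] -/
private theorem sum_erase_facePerturb_nonneg (γ : σ → ℚ) {j : σ} (hj : 0 < γ j) {η : ℚ} (hη : 0 ≤ η) (d : σ →₀ ℕ) :
    0 ≤ ∑ i ∈ Finset.univ.erase j, (d i : ℚ) * (facePerturb γ j η i - γ i) :=
  Finset.sum_nonneg fun _ hi =>
    mul_nonneg (Nat.cast_nonneg _) (sub_nonneg.2 (le_facePerturb γ hj hη (Finset.ne_of_mem_erase hi)))

/-- … and at least the gain `d_i · η/γ_j` of any single lower-weight variable `i`. [folklore] -/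
private theorem mul_le_sum_erase_facePerturb (γ : σ → ℚ) {j : σ} (hj : 0 < γ j) {η : ℚ} (hη : 0 ≤ η) (d : σ →₀ ℕ)
    {i : σ} (hi : γ i < γ j) :
    (d i : ℚ) * (η / γ j) ≤ ∑ i ∈ Finset.univ.erase j, (d i : ℚ) * (facePerturb γ j η i - γ i) := by
  have hij : i ≠ j := fun h => by subst h; exact lt_irrefl _ hi
  have hmem : i ∈ Finset.univ.erase j := Finset.mem_erase.2 ⟨hij, Finset.mem_univ i⟩
  have := Finset.single_le_sum (f := fun i => (d i : ℚ) * (facePerturb γ j η i - γ i))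
    (fun i hi => mul_nonneg (Nat.cast_nonneg _)
      (sub_nonneg.2 (le_facePerturb γ hj hη (Finset.ne_of_mem_erase hi)))) hmem
  simpa [facePerturb_of_lt γ j η hi] using this

/-! ## §2 Admissibility survives the perturbation when `j` has no upper pin (the three cases) -/

variable {K : Type*} [CommRing K]

omit [Fintype σ] in
/-- Combining finitely many "for all small `η`" statements. [folklore] -/
private theorem exists_pos_forall_finset {ι : Type*} [DecidableEq ι] (s : Finset ι) (P : ι → ℚ → Prop)
    (h : ∀ i ∈ s, ∃ ηi : ℚ, 0 < ηi ∧ ∀ η : ℚ, 0 < η → η ≤ ηi → P i η) :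
    ∃ η₀ : ℚ, 0 < η₀ ∧ ∀ η : ℚ, 0 < η → η ≤ η₀ → ∀ i ∈ s, P i η := by
  induction s using Finset.induction_on with
  | empty => exact ⟨1, one_pos, fun η _ _ i hi => absurd hi (Finset.notMem_empty i)⟩
  | insert a s ha ih =>
    obtain ⟨ηa, hηa, hPa⟩ := h a (Finset.mem_insert_self a s)
    obtain ⟨η₀, hη₀, hP⟩ := ih fun i hi => h i (Finset.mem_insert_of_mem hi)
    refine ⟨min ηa η₀, lt_min hηa hη₀, fun η hη hle i hi => ?_⟩
    rcases Finset.mem_insert.1 hi with rfl | hi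
    · exact hPa η hη (hle.trans (min_le_left _ _))
    · exact hP η hη (hle.trans (min_le_right _ _)) i hi

omit [DecidableEq σ] in
/-- **One monomial, three cases.**  If `v_γ(u^d) ≥ 1` and — in case `u^d` is a face monomial through `X_j` — some variable of
`u^d` has weight `< γ_j`, then `v_{γ'}(u^d) ≥ 1` for all small `η > 0`. (derived here)
[cite: AbramovichTemkinWlodarczyk2024, Def. 2.4.1 (2) (p. 1568)] -/
theorem exists_le_monomialValuation_facePerturb [DecidableEq σ] (γ : σ → ℚ) (hγ : ∀ i, 0 ≤ γ i) {j : σ}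
    (hj : 0 < γ j) (d : σ →₀ ℕ) (hd : 1 ≤ monomialValuation γ d)
    (hpin : monomialValuation γ d = 1 → d j ≠ 0 → ∃ i, d i ≠ 0 ∧ γ i < γ j) :
    ∃ ηd : ℚ, 0 < ηd ∧ ∀ η : ℚ, 0 < η → η ≤ ηd → 1 ≤ monomialValuation (facePerturb γ j η) d := by
  by_cases hdj : d j = 0
  · -- case 1: `X_j` does not occur — values only grow
    refine ⟨1, one_pos, fun η hη _ => ?_⟩
    rw [monomialValuation_facePerturb_eq, hdj, Nat.cast_zero, mul_zero, sub_zero]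
    have := sum_erase_facePerturb_nonneg γ hj hη.le d
    linarith
  by_cases hv : monomialValuation γ d = 1
  · -- case 3: a face monomial through `X_j`: a lower-weight variable compensates
    obtain ⟨i, hid, hi⟩ := hpin hv hdj
    refine ⟨1, one_pos, fun η hη _ => ?_⟩
    rw [monomialValuation_facePerturb_eq, hv]
    have hgain := mul_le_sum_erase_facePerturb γ hj hη.le d hi
    have hdjle : (d j : ℚ) * γ j ≤ 1 := hv ▸ mul_le_monomialValuation γ hγ d j
    have hloss : η * d j ≤ η / γ j := by
      rw [le_div_iff₀ hj]
      calc η * d j * γ j = η * ((d j : ℚ) * γ j) := by ring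
        _ ≤ η * 1 := mul_le_mul_of_nonneg_left hdjle hη.le
        _ = η := mul_one η
    have hone : (1 : ℚ) ≤ d i := by exact_mod_cast Nat.one_le_iff_ne_zero.2 hid
    have hgain' : η / γ j ≤ (d i : ℚ) * (η / γ j) :=
      le_mul_of_one_le_left (div_nonneg hη.le hj.le) hone
    linarith
  · -- case 2: valuation `> 1`: the loss `η d_j` is below the gap
    have hv1 : 1 < monomialValuation γ d := lt_of_le_of_ne hd (Ne.symm hv)
    have hdpos : (0 : ℚ) < d j := by exact_mod_cast Nat.pos_of_ne_zero hdj
    refine ⟨(monomialValuation γ d - 1) / d j, div_pos (sub_pos.2 hv1) hdpos, fun η hη hle => ?_⟩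
    rw [monomialValuation_facePerturb_eq]
    have hloss : η * d j ≤ monomialValuation γ d - 1 := (le_div_iff₀ hdpos).1 hle
    have := sum_erase_facePerturb_nonneg γ hj hη.le d
    linarith

/-- **Lemma F1, admissibility half.**  If `γ ≥ 0` is admissible for `F` and the centre variable `j` has no upper pin
(every face monomial of `F` through `X_j` contains a variable of weight `< γ_j`), then `facePerturb γ j η` is admissible for
`F` for all small `η > 0`. (derived here) [cite: AbramovichTemkinWlodarczyk2024, Def. 2.4.1 (2) (p. 1568), Thm. 5.3.1 (2) (p. 1578)] -/
theorem exists_isAdmissibleFor_facePerturb (γ : σ → ℚ) (hγ : ∀ i, 0 ≤ γ i) {j : σ} (hj : 0 < γ j)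
    {F : MvPolynomial σ K} (hF : IsAdmissibleFor γ F)
    (hpin : ∀ d ∈ F.support, monomialValuation γ d = 1 → d j ≠ 0 → ∃ i, d i ≠ 0 ∧ γ i < γ j) :
    ∃ η₀ : ℚ, 0 < η₀ ∧ ∀ η : ℚ, 0 < η → η ≤ η₀ → IsAdmissibleFor (facePerturb γ j η) F := by
  classical
  obtain ⟨η₀, hη₀, h⟩ := exists_pos_forall_finset F.support
    (fun d η => 1 ≤ monomialValuation (facePerturb γ j η) d)
    (fun d hd => exists_le_monomialValuation_facePerturb γ hγ hj d (hF d hd) (hpin d hd))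
  exact ⟨η₀, hη₀, fun η hη hle d hd => h η hη hle d hd⟩

/-- The side conditions `η < γ_j` and `γ_i + η/γ_j < γ_j` (all `i` of lower weight) hold for all small `η > 0`. [folklore] -/
private theorem exists_facePerturb_small (γ : σ → ℚ) {j : σ} (hj : 0 < γ j) :
    ∃ η₁ : ℚ, 0 < η₁ ∧ ∀ η : ℚ, 0 < η → η ≤ η₁ → η < γ j ∧ ∀ i, γ i < γ j → γ i + η / γ j < γ j := by
  classical
  obtain ⟨η₁, hη₁, h⟩ := exists_pos_forall_finset (Finset.univ : Finset σ)
    (fun i η => γ i < γ j → γ i + η / γ j < γ j)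
    (fun i _ => by
      by_cases hi : γ i < γ j
      · refine ⟨γ j * (γ j - γ i) / 2, by nlinarith [mul_pos hj (sub_pos.2 hi)], fun η hη hle _ => ?_⟩
        have h2 : η / γ j ≤ (γ j - γ i) / 2 := by
          rw [div_le_iff₀ hj]
          nlinarith
        nlinarith [sub_pos.2 hi]
      · exact ⟨1, one_pos, fun η _ _ hi' => absurd hi' hi⟩)
  refine ⟨min η₁ (γ j / 2), lt_min hη₁ (half_pos hj), fun η hη hle => ⟨?_, fun i hi => ?_⟩⟩
  · have := hle.trans (min_le_right _ _); linarith
  · exact h η hη (hle.trans (min_le_left _ _)) i (Finset.mem_univ i) hi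

/-! ## §3 The invariant strictly increases -/

omit [Fintype σ] in
/-- For `x ≥ 0` and `θ > 0`: "`x` is a centre weight with entry `x⁻¹ ≤ θ`" iff `θ⁻¹ ≤ x`. [folklore] -/
private theorem ne_zero_and_inv_le_iff {x θ : ℚ} (hx : 0 ≤ x) (hθ : 0 < θ) :
    (x ≠ 0 ∧ x⁻¹ ≤ θ) ↔ θ⁻¹ ≤ x := by
  constructor
  · rintro ⟨hx0, hle⟩
    have hxpos : 0 < x := lt_of_le_of_ne hx (Ne.symm hx0)
    exact (inv_le_comm₀ hxpos hθ).1 hle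
  · intro hle
    have hxpos : 0 < x := lt_of_lt_of_le (inv_pos.2 hθ) hle
    exact ⟨hxpos.ne', (inv_le_comm₀ hxpos hθ).2 hle⟩

omit [Fintype σ] in
/-- For `x ≥ 0` and `θ ≤ 0` no entry is `≤ θ`. [folklore] -/
private theorem not_ne_zero_and_inv_le {x θ : ℚ} (hx : 0 ≤ x) (hθ : θ ≤ 0) : ¬ (x ≠ 0 ∧ x⁻¹ ≤ θ) := by
  rintro ⟨hx0, hle⟩
  have hxpos : 0 < x := lt_of_le_of_ne hx (Ne.symm hx0)
  exact absurd (hle.trans hθ) (not_le.2 (inv_pos.2 hxpos))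

/-- **Lemma F1, order half.**  For `0 < η < γ_j` with `γ_i + η/γ_j < γ_j` for every `i` of lower weight, the invariant strictly
increases: `exps γ <_TL exps (facePerturb γ j η)` — equally many entries `≤ θ` for every `θ < a_j = γ_j⁻¹`, and exactly one
entry fewer `≤ a_j` (the entry of `j` moved up to `1/(γ_j − η)`, the lower-weight entries stay `> a_j`). (derived here)
[cite: AbramovichTemkinWlodarczyk2024, §5.1 (p. 1575) (order of invariants)] -/
theorem truncLex_exps_lt_exps_facePerturb (γ : σ → ℚ) (hγ : ∀ i, 0 ≤ γ i) {j : σ} (hj : 0 < γ j) {η : ℚ}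
    (hη : 0 < η) (hηj : η < γ j) (hsmall : ∀ i, γ i < γ j → γ i + η / γ j < γ j) :
    ATW.TruncLex.lt (exps γ) (exps (facePerturb γ j η)) := by
  classical
  have hγ' : ∀ i, 0 ≤ facePerturb γ j η i := facePerturb_nonneg γ hγ hj hη.le hηj.le
  refine ATW.TruncLex.lt_of_countP _ _ (exps_sorted _) (exps_sorted _) (γ j)⁻¹ (fun θ hθ => ?_) ?_
  · -- equal counts below `a_j`
    rw [countP_exps, countP_exps]
    congr 1
    refine Finset.filter_congr fun i _ => ?_
    by_cases hθ0 : θ ≤ 0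
    · exact iff_of_false (not_ne_zero_and_inv_le (hγ i) hθ0) (not_ne_zero_and_inv_le (hγ' i) hθ0)
    have hθpos : 0 < θ := not_le.1 hθ0
    have hjθ : γ j < θ⁻¹ := by
      rw [← one_div, lt_div_iff₀ hθpos]
      calc γ j * θ = θ * γ j := mul_comm _ _
        _ < (γ j)⁻¹ * γ j := mul_lt_mul_of_pos_right hθ hj
        _ = 1 := inv_mul_cancel₀ hj.ne'
    rw [ne_zero_and_inv_le_iff (hγ i) hθpos, ne_zero_and_inv_le_iff (hγ' i) hθpos]
    by_cases hij : i = j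
    · subst hij
      rw [facePerturb_self]
      exact iff_of_false (not_le.2 hjθ) (not_le.2 (by linarith))
    by_cases hi : γ i < γ j
    · rw [facePerturb_of_lt γ j η hi]
      exact iff_of_false (not_le.2 (hi.trans hjθ)) (not_le.2 ((hsmall i hi).trans hjθ))
    · rw [facePerturb_of_le γ j η hij (not_lt.1 hi)]
  · -- one entry fewer `≤ a_j`
    rw [countP_exps, countP_exps]
    have hθpos : 0 < (γ j)⁻¹ := inv_pos.2 hj
    refine Finset.card_lt_card ((Finset.ssubset_iff_of_subset fun i hi => ?_).2 ⟨j, ?_, ?_⟩)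
    · rw [Finset.mem_filter] at hi ⊢
      refine ⟨hi.1, ?_⟩
      have h2 := (ne_zero_and_inv_le_iff (hγ' i) hθpos).1 hi.2
      rw [inv_inv] at h2
      rw [ne_zero_and_inv_le_iff (hγ i) hθpos, inv_inv]
      by_cases hij : i = j
      · subst hij; exact le_rfl
      by_cases hi' : γ i < γ j
      · exact absurd h2 (not_le.2 (facePerturb_lt_of_lt γ j hi' (hsmall i hi')))
      · exact not_lt.1 hi'
    · rw [Finset.mem_filter]
      exact ⟨Finset.mem_univ j, hj.ne', le_rfl⟩
    · rw [Finset.mem_filter, ne_zero_and_inv_le_iff (hγ' j) hθpos, inv_inv, facePerturb_self]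
      intro h; linarith [h.2]

end Perturb

/-! ## §4 Centre side: no upper pin ⇒ not maximal -/

section Centre

variable {k : Type*} [Field k] {n : ℕ}

/-- **Lemma F1 (centre form).**  Let `(Ψ, γ)` be a centre for `f` and `j` a centre variable (`γ_j > 0`) such that every face
monomial of `Ψ⁻¹ f` through `X_j` contains a variable of weight `< γ_j`.  Then for all small `η > 0`, `(Ψ, facePerturb γ j η)`
is a centre for `f` whose invariant is STRICTLY LARGER: `exps γ <_TL exps γ'`. (derived here)
[cite: AbramovichTemkinWlodarczyk2024, Thm. 5.3.1 (2) (p. 1578), §5.1 (p. 1575)]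
[cite: AbramovichQuekSchober2025, Thm. 3.5 (lex-max over admissible centers)] -/
theorem IsCentreFor.exists_lt_of_no_upperPin {f : MvPolynomial (Fin n) k}
    {Ψ : MvPolynomial (Fin n) k ≃ₐ[k] MvPolynomial (Fin n) k} {γ : Fin n → ℚ} (h : IsCentreFor f Ψ γ)
    {j : Fin n} (hj : 0 < γ j)
    (hpin : ∀ d ∈ (Ψ.symm f).support, monomialValuation γ d = 1 → d j ≠ 0 → ∃ i, d i ≠ 0 ∧ γ i < γ j) :
    ∃ η₀ : ℚ, 0 < η₀ ∧ ∀ η : ℚ, 0 < η → η ≤ η₀ →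
      IsCentreFor f Ψ (facePerturb γ j η) ∧ ATW.TruncLex.lt (exps γ) (exps (facePerturb γ j η)) := by
  obtain ⟨hΨ, hγ, hadm⟩ := h
  obtain ⟨η₀, hη₀, hA⟩ := exists_isAdmissibleFor_facePerturb γ hγ hj hadm hpin
  obtain ⟨η₁, hη₁, hS⟩ := exists_facePerturb_small γ hj
  refine ⟨min η₀ η₁, lt_min hη₀ hη₁, fun η hη hle => ?_⟩
  obtain ⟨hηj, hsmall⟩ := hS η hη (hle.trans (min_le_right _ _))
  exact ⟨⟨hΨ, facePerturb_nonneg γ hγ hj hη.le hηj.le, hA η hη (hle.trans (min_le_left _ _))⟩,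
    truncLex_exps_lt_exps_facePerturb γ hγ hj hη hηj hsmall⟩

/-- **No upper pin ⇒ `exps γ` is not `max W(f)`.** (derived here)
[cite: AbramovichTemkinWlodarczyk2024, Thm. 5.3.1 (2) (p. 1578)] -/
theorem not_isMaxInv_of_no_upperPin {f : MvPolynomial (Fin n) k}
    {Ψ : MvPolynomial (Fin n) k ≃ₐ[k] MvPolynomial (Fin n) k} {γ : Fin n → ℚ} (h : IsCentreFor f Ψ γ)
    {j : Fin n} (hj : 0 < γ j)
    (hpin : ∀ d ∈ (Ψ.symm f).support, monomialValuation γ d = 1 → d j ≠ 0 → ∃ i, d i ≠ 0 ∧ γ i < γ j) :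
    ¬ IsMaxInv (admissibleInvariants f) (exps γ) := by
  obtain ⟨η₀, hη₀, hη⟩ := h.exists_lt_of_no_upperPin hj hpin
  obtain ⟨hc, hlt⟩ := hη η₀ hη₀ le_rfl
  exact fun hmax => hmax.2 _ (exps_mem_admissibleInvariants hc) hlt

/-- **At a maximal centre every centre variable is upper-pinned**: if `(Ψ, γ)` attains `max W(f)` and `γ_j > 0`, there is a
face monomial `u^d` of `Ψ⁻¹ f` (`v_γ(u^d) = 1`) with `d_j ≥ 1` all of whose variables have weight `≥ γ_j`. (derived here)
[cite: AbramovichTemkinWlodarczyk2024, Thm. 5.3.1 (2) (p. 1578)]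
[cite: AbramovichQuekSchober2025, Thm. 3.5 (lex-max over admissible centers)] -/
theorem exists_upperPin_of_isMaxInv {f : MvPolynomial (Fin n) k}
    {Ψ : MvPolynomial (Fin n) k ≃ₐ[k] MvPolynomial (Fin n) k} {γ : Fin n → ℚ} (h : IsCentreFor f Ψ γ)
    (hmax : IsMaxInv (admissibleInvariants f) (exps γ)) {j : Fin n} (hj : 0 < γ j) :
    ∃ d ∈ (Ψ.symm f).support, monomialValuation γ d = 1 ∧ d j ≠ 0 ∧ ∀ i, d i ≠ 0 → γ j ≤ γ i := by
  by_contra hno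
  refine not_isMaxInv_of_no_upperPin h hj (fun d hd hv hdj => ?_) hmax
  by_contra hno'
  refine hno ⟨d, hd, hv, hdj, fun i hi => ?_⟩
  by_contra hlt
  exact hno' ⟨i, hi, not_le.1 hlt⟩

end Centre

/-! ## §5 A worked instance: `F = X₀X₁ + X₁³`, `γ = (2/3, 1/3)`, `η = 2/15` -/

section Example

variable {K : Type*} [CommRing K]

/-- `γ = (2/3, 1/3)` perturbed at `j = 0` with `η = 2/15` is `(8/15, 8/15)`. [folklore] -/
example : facePerturb (fun i : Fin 2 => if i = 0 then (2/3 : ℚ) else 1/3) 0 (2/15) = fun _ => 8/15 := by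
  funext i
  fin_cases i <;> simp [facePerturb] <;> norm_num

/-- The order half on the instance: `[3/2, 3] <_TL exps (8/15, 8/15)` (`= [15/8, 15/8]`). [folklore] -/
example : ATW.TruncLex.lt (exps (fun i : Fin 2 => if i = 0 then (2/3 : ℚ) else 1/3))
    (exps (facePerturb (fun i : Fin 2 => if i = 0 then (2/3 : ℚ) else 1/3) 0 (2/15))) := by
  refine truncLex_exps_lt_exps_facePerturb _ (fun i => ?_) (j := 0) (by norm_num) (by norm_num) (by norm_num)
    (fun i hi => ?_)
  · fin_cases i <;> norm_num
  · fin_cases i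
    · simp at hi
    · simp; norm_num

/-- The weights `γ₀ = (2/3, 1/3)` of the instance. [folklore] -/
private def γ₀ : Fin 2 → ℚ := fun i => if i = 0 then 2/3 else 1/3

/-- The support of `X₀X₁ + X₁³`. [folklore] -/
private theorem support_inst_subset {k : Type*} [Field k] :
    (X 0 * X 1 + X 1 ^ 3 : MvPolynomial (Fin 2) k).support ⊆
      {Finsupp.single 0 1 + Finsupp.single 1 1, Finsupp.single 1 3} := by
  intro d hd
  have h01 : (X 0 * X 1 : MvPolynomial (Fin 2) k) = monomial (Finsupp.single 0 1 + Finsupp.single 1 1) 1 := by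
    rw [X, X, monomial_mul, one_mul]
  have h13 : (X 1 ^ 3 : MvPolynomial (Fin 2) k) = monomial (Finsupp.single 1 3) 1 := by
    rw [X_pow_eq_monomial]
  rw [h01, h13] at hd
  have := support_add hd
  rw [Finset.mem_union] at this
  rw [Finset.mem_insert, Finset.mem_singleton]
  rcases this with h | h
  · exact Or.inl (Finset.mem_singleton.1 (support_monomial_subset h))
  · exact Or.inr (Finset.mem_singleton.1 (support_monomial_subset h))

/-- **The instance, centre form**: the coordinate centre `(X₀, X₁; 2/3, 1/3)` is admissible for `X₀X₁ + X₁³` but `X₀` has no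
upper pin (its only face monomial `X₀X₁` contains the lower-weight variable `X₁`), so its invariant `exps γ₀` (`= [3/2, 3]`) is
not `max W(X₀X₁ + X₁³)`. (derived here) [cite: AbramovichTemkinWlodarczyk2024, Thm. 5.3.1 (2) (p. 1578)] -/
example {k : Type*} [Field k] :
    ¬ IsMaxInv (admissibleInvariants (X 0 * X 1 + X 1 ^ 3 : MvPolynomial (Fin 2) k)) (exps γ₀) := by
  have hval01 : monomialValuation γ₀ (Finsupp.single (0 : Fin 2) 1 + Finsupp.single 1 1) = 1 := by
    rw [monomialValuation_eq_sum, Fin.sum_univ_two]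
    norm_num [γ₀]
  have hval13 : monomialValuation γ₀ (Finsupp.single (1 : Fin 2) 3) = 1 := by
    rw [monomialValuation_eq_sum, Fin.sum_univ_two]
    norm_num [γ₀]
  have hc : IsCentreFor (X 0 * X 1 + X 1 ^ 3 : MvPolynomial (Fin 2) k) AlgEquiv.refl γ₀ := by
    refine ⟨fun i => by simp, fun i => ?_, fun d hd => ?_⟩
    · fin_cases i <;> norm_num [γ₀]
    · change d ∈ (X 0 * X 1 + X 1 ^ 3 : MvPolynomial (Fin 2) k).support at hd
      have := support_inst_subset hd
      rw [Finset.mem_insert, Finset.mem_singleton] at this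
      rcases this with rfl | rfl
      · rw [hval01]
      · rw [hval13]
  refine not_isMaxInv_of_no_upperPin hc (j := 0) (by simp [γ₀]) fun d hd _ hd0 => ?_
  change d ∈ (X 0 * X 1 + X 1 ^ 3 : MvPolynomial (Fin 2) k).support at hd
  have := support_inst_subset hd
  rw [Finset.mem_insert, Finset.mem_singleton] at this
  rcases this with rfl | rfl
  · exact ⟨1, by simp, by simp [γ₀]; norm_num⟩
  · simp at hd0

end Example

end WeightedBlowup

end Literature.AlgebraicGeometry.Resolution
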